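import Literature.Analysis.Fourier.TorusProductClass
import Literature.Analysis.Fourier.TransferCoefficients
import Literature.NumberTheory.Transcendental.LexExtremeCoefficient
import Mathlib.Algebra.MvPolynomial.Eval
import Mathlib.Tactic
import HarnessLib

/-!
# The dampened Cauchy bound for the lowest coefficient (CDT eqs. (6.21)–(6.22))

Calegari–Dimitrov–Tang, arXiv:2408.15403, §6.5.3 (pp. 53–54): for `G` in the product class
(`TorusProductClass`: `G = Σ_j c_j Π_s w_{j,s}(z_s)`, `w_{j,s}` holomorphic near the closed unit disc,
torus coefficients `a = sumProdCoeff`) and a polynomial dampener `W` (the power `V_S^M` of a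
Vandermonde-type product), the product `W · G` is again in the product class
(`sum_prod_dampened_eq`), its torus coefficients are the power-series product `W · a`
(`sumProdCoeff_dampened_eq_coeff_mul`), hence every coefficient of `W · a` is bounded by
`sup_{𝕋^d} |W G|` (`norm_coeff_dampened_le`); combined with the lexicographic extraction
`[𝐳^{Mρ + 𝐧}](V^M G) = [𝐳^𝐧] G` (`coeff_vprod_pow_mul`) this bounds the lexicographically highest
minimal-degree coefficient of `G` by `sup_{𝕋^d} |V^M G|` (`norm_lexExtreme_coeff_le`) — eq. (6.22).

* `toMv a` — a coefficient family as a multivariate power series.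

No named facts.

## References

* [CalegariDimitrovTang2024] arXiv:2408.15403, §6.5.3 eqs. (6.21)–(6.22).
* [CalegariDimitrovTang2025] arXiv:2109.09040, §2.5.3 (the lexicographic extraction).
-/

noncomputable section

open Complex Metric Finset Literature.Analysis.Fourier.TorusCoeff

open scoped Real NNReal

namespace Literature.NumberTheory.Transcendental

namespace CalegariDimitrovTang

variable {d : ℕ}

/-- A coefficient family `(Fin d → ℕ) → ℂ` as a multivariate power series. [folklore] -/
def toMv (a : (Fin d → ℕ) → ℂ) : MvPowerSeries (Fin d) ℂ := fun n => a n

/-- Coefficients of `toMv a`. [folklore] -/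
@[simp] theorem coeff_toMv (a : (Fin d → ℕ) → ℂ) (n : Fin d →₀ ℕ) :
    MvPowerSeries.coeff n (toMv a) = a n := rfl

/-! ### The dampened function is in the product class -/

section Dampened

variable {ι : Type*} (S : Finset ι) (c : ι → ℂ) (w : ι → Fin d → ℂ → ℂ) (P : MvPolynomial (Fin d) ℂ)

/-- Index set, coefficients and factors of the dampened sum `P · Σ_j c_j Π_s w_{j,s}`. [folklore] -/
def dIdx : Finset ((Fin d →₀ ℕ) × ι) := P.support ×ˢ S

/-- Coefficients `P_𝐞 c_j`. [folklore] -/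
def dCoef (ej : (Fin d →₀ ℕ) × ι) : ℂ := P.coeff ej.1 * c ej.2

/-- Factors `z ↦ z^{e_s} w_{j,s}(z)`. [folklore] -/
def dFac (ej : (Fin d →₀ ℕ) × ι) (s : Fin d) : ℂ → ℂ := fun z => z ^ (ej.1 s) * w ej.2 s z

/-- The factors are holomorphic where the `w_{j,s}` are. [folklore] -/
theorem differentiableOn_dFac {R : ℝ≥0} (hw : ∀ j ∈ S, ∀ t, DifferentiableOn ℂ (w j t) (closedBall 0 R)) :
    ∀ ej ∈ dIdx S P, ∀ t, DifferentiableOn ℂ (dFac w ej t) (closedBall 0 R) := by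
  intro ej hej t
  rw [dIdx, Finset.mem_product] at hej
  unfold dFac
  exact (differentiableOn_pow _).mul (hw ej.2 hej.2 t)

/-- **`P · G` on the torus is the product-class sum over `dIdx`.**
[cite: CalegariDimitrovTang2024, §6.5.3 (W G holomorphic near the closed polydisc)] -/
theorem sum_prod_dampened_eq (θ : Fin d → ℝ) :
    ∑ ej ∈ dIdx S P, dCoef c P ej * ∏ t, dFac w ej t (Complex.exp (2 * π * I * θ t)) =
      MvPolynomial.eval (fun s => Complex.exp (2 * π * I * θ s)) P *
        ∑ j ∈ S, c j * ∏ t, w j t (Complex.exp (2 * π * I * θ t)) := by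
  rw [dIdx, Finset.sum_product, MvPolynomial.eval_eq', Finset.sum_mul]
  refine Finset.sum_congr rfl fun e _ => ?_
  rw [Finset.mul_sum]
  refine Finset.sum_congr rfl fun j _ => ?_
  simp only [dCoef, dFac]
  rw [Finset.prod_mul_distrib]
  ring

/-- **The torus coefficients of `P · G` are the power-series product `P · a`.**
[cite: CalegariDimitrovTang2024, §6.5.3 eq. (6.21)] -/
theorem sumProdCoeff_dampened_eq_coeff_mul {R : ℝ≥0} (hR : 0 < R)
    (hw : ∀ j ∈ S, ∀ t, DifferentiableOn ℂ (w j t) (closedBall 0 R)) (ν : Fin d →₀ ℕ) :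
    sumProdCoeff (dIdx S P) (dCoef c P) (dFac w) R ν =
      MvPowerSeries.coeff ν ((P : MvPowerSeries (Fin d) ℂ) * toMv (sumProdCoeff S c w R)) := by
  classical
  -- left side: shift each factor
  have hL : sumProdCoeff (dIdx S P) (dCoef c P) (dFac w) R ν =
      ∑ e ∈ P.support.filter (fun e => e ≤ ν), P.coeff e * sumProdCoeff S c w R ⇑(ν - e) := by
    unfold sumProdCoeff
    rw [dIdx, Finset.sum_product, Finset.sum_filter]
    refine Finset.sum_congr rfl fun e _ => ?_
    have hterm : ∀ j ∈ S, dCoef c P (e, j) * ∏ t, taylorCoeff (dFac w (e, j) t) R (ν t) =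
        P.coeff e * (c j * if e ≤ ν then ∏ t, taylorCoeff (w j t) R (ν t - e t) else 0) := by
      intro j hj
      simp only [dCoef]
      have hfac : ∀ t, taylorCoeff (dFac w (e, j) t) R (ν t) =
          if e t ≤ ν t then taylorCoeff (w j t) R (ν t - e t) else 0 := fun t =>
        taylorCoeff_pow_mul hR (hw j hj t) (e t) (ν t)
      rw [Finset.prod_congr rfl fun t _ => hfac t]
      by_cases hle : e ≤ ν
      · rw [if_pos hle, Finset.prod_congr rfl fun t _ => if_pos (hle t)]; ring
      · rw [if_neg hle, mul_zero, mul_zero]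
        obtain ⟨t, ht⟩ : ∃ t, ¬ e t ≤ ν t := by
          by_contra hall; push Not at hall; exact hle fun t => hall t
        exact mul_eq_zero_of_right _ (Finset.prod_eq_zero (Finset.mem_univ t) (if_neg ht))
    rw [Finset.sum_congr rfl hterm, ← Finset.mul_sum]
    split_ifs with hle
    · -- `(ν - e) t = ν t - e t` definitionally
      congr 1
    · simp
  -- right side: the Cauchy product restricted to the support of `P`
  have hRt : MvPowerSeries.coeff ν ((P : MvPowerSeries (Fin d) ℂ) * toMv (sumProdCoeff S c w R)) =
      ∑ e ∈ P.support.filter (fun e => e ≤ ν), P.coeff e * sumProdCoeff S c w R ⇑(ν - e) := by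
    rw [MvPowerSeries.coeff_mul]
    simp_rw [MvPolynomial.coeff_coe, coeff_toMv]
    have hvan : ∀ p ∈ Finset.antidiagonal ν,
        P.coeff p.1 * sumProdCoeff S c w R ⇑p.2 ≠ 0 → p.1 ∈ P.support := by
      intro p _ hne
      by_contra hns
      rw [MvPolynomial.notMem_support_iff] at hns
      exact hne (by rw [hns, zero_mul])
    rw [← Finset.sum_filter_of_ne hvan]
    symm
    refine Finset.sum_nbij' (fun e => (e, ν - e)) (fun p => p.1) ?_ ?_ ?_ ?_ ?_
    · intro e he
      rw [Finset.mem_filter] at he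
      rw [Finset.mem_filter, Finset.mem_antidiagonal]
      exact ⟨add_tsub_cancel_of_le he.2, he.1⟩
    · intro p hp
      rw [Finset.mem_filter, Finset.mem_antidiagonal] at hp
      rw [Finset.mem_filter]
      exact ⟨hp.2, hp.1 ▸ le_self_add⟩
    · intro e _; rfl
    · intro p hp
      rw [Finset.mem_filter, Finset.mem_antidiagonal] at hp
      show (p.1, ν - p.1) = p
      ext : 1
      · rfl
      · show ν - p.1 = p.2
        rw [← hp.1, add_tsub_cancel_left]
    · intro e _; rfl
  rw [hL, hRt]

/-- **Every coefficient of `P · a` is bounded by `sup_{𝕋^d} |P G|`.**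
[cite: CalegariDimitrovTang2024, §6.5.3 eq. (6.21)–(6.22)] -/
theorem norm_coeff_dampened_le {R : ℝ≥0} (hR : 1 < R)
    (hw : ∀ j ∈ S, ∀ t, DifferentiableOn ℂ (w j t) (closedBall 0 R)) {B : ℝ}
    (hB : ∀ θ : Fin d → ℝ, ‖MvPolynomial.eval (fun s => Complex.exp (2 * π * I * θ s)) P *
      ∑ j ∈ S, c j * ∏ t, w j t (Complex.exp (2 * π * I * θ t))‖ ≤ B)
    (ν : Fin d →₀ ℕ) :
    ‖MvPowerSeries.coeff ν ((P : MvPowerSeries (Fin d) ℂ) * toMv (sumProdCoeff S c w R))‖ ≤ B := by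
  rw [← sumProdCoeff_dampened_eq_coeff_mul S c w P (lt_trans zero_lt_one hR) hw ν]
  refine norm_sumProdCoeff_le (dIdx S P) (dCoef c P) (dFac w) hR (differentiableOn_dFac S w P hw)
    (fun θ => ?_) ⇑ν
  rw [sum_prod_dampened_eq]
  exact hB θ

/-- **CDT eq. (6.22): the dampened Cauchy bound for the lowest coefficient.** If `𝐧` is
lexicographically highest among the minimal-degree exponents of the torus coefficients `a` of
`G = Σ_j c_j Π_s w_{j,s}`, then for the dampener `V_{S'}^M`:
`|a_𝐧| ≤ sup_{𝕋^d} |V_{S'}^M · G|`.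
[cite: CalegariDimitrovTang2024, §6.5.3 eqs. (6.21)–(6.22); CalegariDimitrovTang2025, §2.5.3] -/
theorem norm_lexExtreme_coeff_le (S' : Finset (Fin d × Fin d)) (hS' : ∀ p ∈ S', p.1 < p.2) (M : ℕ)
    {R : ℝ≥0} (hR : 1 < R) (hw : ∀ j ∈ S, ∀ t, DifferentiableOn ℂ (w j t) (closedBall 0 R))
    {β : ℕ} {n : Fin d →₀ ℕ}
    (hGdeg : ∀ ν : Fin d →₀ ℕ, sumProdCoeff S c w R ⇑ν ≠ 0 → β ≤ ν.degree)
    (hGlex : ∀ ν : Fin d →₀ ℕ, sumProdCoeff S c w R ⇑ν ≠ 0 → ν.degree = β → toLex ν ≤ toLex n)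
    (hn : n.degree = β) {B : ℝ}
    (hB : ∀ θ : Fin d → ℝ,
      ‖MvPolynomial.eval (fun s => Complex.exp (2 * π * I * θ s)) ((vprod S' : MvPolynomial (Fin d) ℂ) ^ M) *
        ∑ j ∈ S, c j * ∏ t, w j t (Complex.exp (2 * π * I * θ t))‖ ≤ B) :
    ‖sumProdCoeff S c w R ⇑n‖ ≤ B := by
  have key := coeff_vprod_pow_mul (R := ℂ) S' hS' M (toMv (sumProdCoeff S c w R)) (β := β) (n := n)
    hGdeg hGlex hn
  rw [coeff_toMv] at key
  rw [← key]
  exact norm_coeff_dampened_le S c w _ hR hw hB _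

end Dampened

end CalegariDimitrovTang

end Literature.NumberTheory.Transcendental
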